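import Summits.CriticalPhenomena.SAWScalingLimit.Theses.SAWTotalPositivity
import Summits.CriticalPhenomena.SAWScalingLimit.Theorems.SAWTotalPositivityBoundaryTP2Defs
import Summits.CriticalPhenomena.SAWScalingLimit.Theorems.SAWTotalPositivityBoundaryTP2Kernel
import Summits.CriticalPhenomena.SAWScalingLimit.Theorems.SAWTotalPositivityBoundaryTP2Symmetry
import Summits.CriticalPhenomena.SAWScalingLimit.Theorems.SAWTotalPositivityBoundaryTP2SquareGadget
import Summits.CriticalPhenomena.SAWScalingLimit.Theorems.SAWTotalPositivityBoundaryTP2RectFacingPairs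
import Summits.CriticalPhenomena.SAWScalingLimit.Theorems.SAWTotalPositivityBoundaryTP2RectReflect
import Summits.CriticalPhenomena.SAWScalingLimit.Theorems.SAWTotalPositivityBoundaryTP2LadderAll
import Summits.CriticalPhenomena.SAWScalingLimit.Theorems.EdgeOfPositivity.Negative.EdgeOfPositivityRectDomain
import Summits.CriticalPhenomena.SAWScalingLimit.Theorems.SAWTotalPositivityBoundaryTP2Strip3Base
import Summits.CriticalPhenomena.SAWScalingLimit.Theorems.SAWTotalPositivityBoundaryTP2Strip3RecMid
import Summits.CriticalPhenomena.SAWScalingLimit.Theorems.SAWTotalPositivityBoundaryTP2Strip3RecCorner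
import Summits.CriticalPhenomena.SAWScalingLimit.Theorems.SAWTotalPositivityBoundaryTP2Strip3RecPair
import Summits.CriticalPhenomena.SAWScalingLimit.Theorems.SAWTotalPositivityBoundaryTP2Strip3Interlaced
import Summits.CriticalPhenomena.SAWScalingLimit.Theorems.SAWTotalPositivityBoundaryTP2Strip3EndLower
import Summits.CriticalPhenomena.SAWScalingLimit.Theorems.SAWTotalPositivityBoundaryTP2Strip3OddCone
import Summits.CriticalPhenomena.SAWScalingLimit.Theorems.SAWTotalPositivityBoundaryTP2Strip3EvenSigns
import Summits.CriticalPhenomena.SAWScalingLimit.Theorems.SAWTotalPositivityBoundaryTP2Strip3CertM2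
import Summits.CriticalPhenomena.SAWScalingLimit.Theorems.SAWTotalPositivityBoundaryTP2Strip3EndBounds
import Summits.CriticalPhenomena.SAWScalingLimit.Theorems.SAWTotalPositivityBoundaryTP2Strip3OddOscillation
import Summits.CriticalPhenomena.SAWScalingLimit.Theorems.SAWTotalPositivityBoundaryTP2Strip3FacingTyped
import Summits.CriticalPhenomena.SAWScalingLimit.Theorems.SAWTotalPositivityBoundaryTP2Strip3Corner
import Summits.CriticalPhenomena.SAWScalingLimit.Theorems.SAWTotalPositivityBoundaryTP2Strip4Interlaced
import Summits.CriticalPhenomena.SAWScalingLimit.Theorems.SAWTotalPositivityBoundaryTP2Strip4Base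
import Summits.CriticalPhenomena.SAWScalingLimit.Theorems.SAWTotalPositivityBoundaryTP2Strip4RecNear
import Summits.CriticalPhenomena.SAWScalingLimit.Theorems.SAWTotalPositivityBoundaryTP2Strip4RecPair201
import Summits.CriticalPhenomena.SAWScalingLimit.Theorems.SAWTotalPositivityBoundaryTP2Strip4RecCorner
import Summits.CriticalPhenomena.SAWScalingLimit.Theorems.SAWTotalPositivityBoundaryTP2Strip4RecPair301
import Summits.CriticalPhenomena.SAWScalingLimit.Theorems.SAWTotalPositivityBoundaryTP2Strip4RecPair302
import Summits.CriticalPhenomena.SAWScalingLimit.Theorems.SAWTotalPositivityBoundaryTP2Strip4RecPair312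
import Summits.CriticalPhenomena.SAWScalingLimit.Theorems.SAWTotalPositivityBoundaryTP2Strip4PairSym
import Summits.CriticalPhenomena.SAWScalingLimit.Theorems.SAWTotalPositivityBoundaryTP2Strip4OddBoxStep
import Summits.CriticalPhenomena.SAWScalingLimit.Theorems.SAWTotalPositivityBoundaryTP2Strip4OddBoxBase03
import Summits.CriticalPhenomena.SAWScalingLimit.Theorems.SAWTotalPositivityBoundaryTP2Strip4OddBoxBase12
import Summits.CriticalPhenomena.SAWScalingLimit.Theorems.SAWTotalPositivityBoundaryTP2Strip4EvenBoxStep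
import Summits.CriticalPhenomena.SAWScalingLimit.Theorems.SAWTotalPositivityBoundaryTP2Strip4EvenBoxBase03
import Summits.CriticalPhenomena.SAWScalingLimit.Theorems.SAWTotalPositivityBoundaryTP2Strip4EvenBoxBase12
import Summits.CriticalPhenomena.SAWScalingLimit.Theorems.SAWTotalPositivityBoundaryTP2Strip4Corner
import Summits.CriticalPhenomena.SAWScalingLimit.Theorems.SAWTotalPositivityBoundaryTP2StripCertIter
import Summits.CriticalPhenomena.SAWScalingLimit.Theorems.SAWTotalPositivityBoundaryTP2Strip4TP2
import Summits.CriticalPhenomena.SAWScalingLimit.Theorems.SAWTotalPositivityBoundaryTP2Strip4EndD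
import Literature.Probability.RandomPlanarGeometry.SelfAvoidingWalkProofs
import HarnessLib

/-!
# SKELETON v22 — crux `BoundaryTP2` (stmt-CriticalPhenomena-7115), line `Sketch` (lead c6)

Composition (`BoundaryTP2_of`): the crux as typed follows from its combinatorial core
`GraphTP2At x_c` through the LANDED transfer `boundaryTP2_of_graphTP2At`
(`…Theorems/SAWTotalPositivityBoundaryTP2Kernel.lean`).  ONE load-bearing stub: `stub_graphTP2`
(the core = the crux; a new conjecture, not in print; OPEN after c0–c5 and the strategist's census).

Cycle c6 registers, next to the core, the TOOL stubs of the **3-row strip programme** (not consumed by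
the composition): the crux AS TYPED for every two-left/two-right quadruple (⊇ the four corners) of
every strip `rectDomain L 2 = {0..L} × {0,1,2}`, all `L ≥ 1` — the first all-sizes family with an
ENTANGLED (3-edge) cut, where no closed form exists.  Mathematics (lead; validated by exact enumeration
for `L ≤ 5`, `exp/strip3.py`):

* a 5-state LAST-COLUMN TRANSFER RECURSION for the kernels from the left column: with
  `Z_L(r→s) = Z_{S_L}((0,r),(L,s))` and the disjoint-pair kernels
  `PP_L(r;s) = Σ_{γ:(0,r)→(L,s), γ':(L,1)→(L,2-s), γ∩γ'=∅} x^{|γ|+|γ'|}` (`s ∈ {0,2}`),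
  `Z_{L+1}(r→s) = x Z_L(r→s) + x² Z_L(r→1) + x³ Z_L(r→2-s) + x⁴ PP_L(r;2-s)`   (`stub_strip3_recCorner`),
  `Z_{L+1}(r→1) = x² Z_L(r→0) + x Z_L(r→1) + x² Z_L(r→2)`                    (`stub_strip3_recMid`),
  `PP_{L+1}(r;s) = x² Z_L(r→s) + x³ PP_L(r;s)`                                (`stub_strip3_recPair`),
  the only planar input being "a left–right crossing meets a top–bottom crossing"
  (`stub_strip3_interlaced`), and the single-column base values (`stub_strip3_base`);
* the reflection splits the recursion into an ODD 2×2 sector `D = a-c, R = PP₀-PP₂`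
  (`D' = x(1-x²)D - x⁴R`, `R' = x²D + x³R`, eigenvalues `x(1±√(1-4x²))/2`, real iff `x ≤ 1/2` — exactly
  the all-`L` threshold `x₀ᴬ(L) ↓ 0.50` seen numerically by c5) and an EVEN 3×3 sector
  `T_e = [[x+x³,2x²,x⁴],[x²,x,0],[x²,0,x³]]` whose second compound is sign-similar to a non-negative
  matrix; hence the corner/facing inequality `Z((0,0),(L,2)) ≤ Z((0,0),(L,0))` for ALL `L` on
  `[0,1/2]` by the invariant cone `0 ≤ R ≤ 2D` (`stub_strip3_oddCone`), the minor `ae ≥ b²` for free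
  (`stub_strip3_evenSigns`), the delicate minor `b² ≥ ce` by a rate certificate on the unconditional
  enclosure `x_c ∈ [1/3, 5/13]` (`stub_strip3_certM2`), and the end-pair inequalities by decay bounds
  (`stub_strip3_endBounds`, `stub_strip3_endLower`).
The analytic stubs are PURE REAL statements about sequences satisfying the recursions (no graph theory);
the lead's bridge + assembly instantiates them with the kernels (`ENNReal.toReal`) and lands the typed
family.  Only the core remains load-bearing in this skeleton.
-/

noncomputable section

namespace Summit.CriticalPhenomena.SAWScalingLimit.Theorems.BoundaryTP2

open Literature.Probability.LatticeModels Literature.Probability.RandomPlanarGeometry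
open Summit.CriticalPhenomena.SAWScalingLimit.Theorems.EdgeOfPositivity.Negative
open scoped ENNReal

/-! ## Registered stubs -/

/-- STUB (core, held by the lead). The combinatorial core of the crux at `x_c`: for every `H ≤ ℤ²` with
finitely many non-isolated vertices and every quadruple with (i) interlacing, (ii)/(iii) the two nested
pairings disjointly realisable, `Z(p₁,p₃)Z(p₂,p₄) ≤ Z(p₁,p₂)Z(p₃,p₄)` for `Z = pathKernel H x_c`. OPEN. -/
theorem stub_graphTP2 : GraphTP2At SAW.criticalFugacity := by
  sorry

/-! ### c6 LANDED tool stubs (all imported above; `--supports stmt-CriticalPhenomena-7115`)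
Width 3 (`rectDomain L 2`): `stub_strip3_recCorner` (p161382, Aux p160808), `stub_strip3_recMid` (p160166),
`stub_strip3_recPair` (p160860), `stub_strip3_interlaced` (p159789), `stub_strip3_base` (p159976),
`stub_strip3_endLower` (p160108), `stub_strip3_oddCone` (p159764), `stub_strip3_evenSigns` (p159806),
`stub_strip3_certM2` (p160378), `stub_strip3_endBounds` (p160277), `stub_strip3_oddOscillation` (p162045);
lead compositions `strip3_kernel_ineqs` (p161780), `strip3_facing_tp2` / `boundaryTP2_strip3_facing` (p162211:
the crux AS TYPED on every two-left/two-right quadruple of every 3-row strip, given `x_c ≤ 5/13`),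
`strip3_diag_le_side` (p162088), `strip3_corner_forall_iff` (p162298: corner inequality ∀L ⇔ x ≤ 1/2).
Width 4 (`rectDomain L 3`): `stub_strip4_interlaced` (p161972), `stub_strip4_base` (p162486),
`stub_strip4_recNear` (p162499), `stub_strip4_recPair201` (p163036, Aux p162870), pair-sum symmetries
(p163201), `stub_strip4_oddBoxStep` (p163336), `stub_strip4_oddBoxBase03` (p163357), `stub_strip4_oddBoxBase12`
(p163372), `stub_strip4_recCorner` (p164456, Aux p163019).  `stub_strip4_recPair302` (p164714, Aux p164522), `stub_strip4_recPair301` (p165198, Aux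
p163168), `stub_strip4_recPair312` (p165262, Aux p163291) — ALL width-4 combinatorial stubs landed; lead bridge `strip4_oddSector_exists` (work/Strip4OddBridge.lean). -/

/-! ### c6: THE WIDTH-4 PROGRAMME IS COMPLETE (all imported above).  Tool stubs (workers): interlaced p161972, base p162486,
recCorner p164456, recNear p162499, recPair201 p163036, recPair301 p165198, recPair302 p164714, recPair312 p165262 (+Aux), odd/even
box cones p163336/p163357/p163372, p165746/p165753/p165742.  Lead: bridges p167600/p167661, corner family p167662, kernel table
p171216, the kernel-decidable ALL-LENGTH certificate kit `StripCert` (Poly p166814, Box p167552, Iter p169702, W4Data p170627,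
W4Base p170672, W4Direct p170673, W4End p171217, W4EndDirect p171295), sector trajectories p170674, tail p171294,
**Strip4TP2 p171368: `strip4_tp2` — TP₂ of the 4×4 kernel matrix `K_n(r,s) = Z((0,r),(n,s))` of EVERY 4-row strip, every `n`,
every `x ∈ [1/3,5/13]`; `boundaryTP2_strip4` — the crux AS TYPED (crossing/facing' labelling) on EVERY two-left/two-right
quadruple of EVERY `rectDomain n 3`, `n ≥ 1`, at `x_c` given `x_c ≤ 5/13`**, and the end-pair labelling EndA–D p171296/p171369/
p171581/**p171629: `strip4_endPair`, `boundaryTP2_strip4_facing` — the other labelling; together BOTH labellings**.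
Width 3 (both labellings) was completed earlier this cycle (p162211 etc.).  Only the core remains in this skeleton. -/

/-! ## Composition -/

/-- **Composition of the line**: the crux `BoundaryTP2`, by name, from the registered core stub through the
landed transfer `boundaryTP2_of_graphTP2At`. -/
theorem BoundaryTP2_of :
    Summit.CriticalPhenomena.SAWScalingLimit.Theses.SAWTotalPositivity.BoundaryTP2 :=
  boundaryTP2_of_graphTP2At stub_graphTP2

end Summit.CriticalPhenomena.SAWScalingLimit.Theorems.BoundaryTP2
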